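/-
Literature/NumberTheory/ComplexMultiplication/WhiteSporadicSetCosetCube.lean — pub-hodgecm2 (COR-CM), KEPT Literature lane lit-deligne-3 gen 67,
file F67e.  THEOREMS ONLY (no `def`, no named fact, no `sorry`, no instance, no notation; D-0026 net debt 0).  HC_CM is NOT proved.
-/
import Literature.NumberTheory.ComplexMultiplication.DegenerateCMTypesAbelianSporadicSubsets
import HarnessLib

/-!
# White's sporadic set is a coset cube: `Δ = ⋃_{T ⊆ odd primes of N} c^{|T|}·σ_T·H`

S. P. White, *Sporadic cycles on CM abelian varieties*, Compositio Math. 88 (1993), §4 Lemma 3 (p. 131): for an odd character `χ` of the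
finite abelian group `G` with kernel `H`, `G/H = ⟨σ⟩` cyclic of order `N = 2m`, `σ^m = c`, the element `β = Π_{p ∣ 2m}(1 − σ^{2m/p})·H` of
`ℚ[G]⁻` has coefficients `0, ±1`, "since the order of a typical product `σ^{2m/p₁}⋯σ^{2m/p_t}H` is exactly `p₁⋯p_t`, different for each
product", and (Thm. 3) `β = Δ⁻¹ − cΔ⁻¹` gives the sporadic "line" `Δ`.  The tree renders `β` through the character
(`WhiteLenstra.whiteFun`: `β(x) = Σ_{T ⊆ primes(N)} (−1)^{|T|}[χ(x) = z_T]`, `z_T = Π_{p∈T} e^{2πi/p}`) and `Δ = {β = 1}` (`WhiteLenstra.whiteSet`,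
`mem_whiteSet_iff`: `x ∈ Δ ⟺ χ(x) = z_T` for some `T` of even size).

THIS FILE makes the factor `p = 2` of White's product explicit (`σ^{2m/2} = c`, `ζ₂ = −1`): splitting `T = T_odd ∪ (T ∩ {2})`, the parity
condition `|T|` even reads `2 ∈ T ⟺ |T_odd|` odd, so

  `Δ = ⋃_{T ⊆ primes(N) ∖ {2}}  c^{[|T| odd]} · (Π_{q∈T} x_q) · H`      (`χ(x_q) = ζ_q`, i.e. `x_q H = σ^{N/q} H`, of order `q` in `G/H`)

(`mem_whiteSet_iff_exists_coset`, `whiteSet_eq_biUnion`): White's `Δ` is the MIXED-DIFFERENCE CUBE of the kernel `H` with base coset `H`, displacements the prime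
torsion `x_q H` of the odd part of `G/H`, and the conjugate base `cH` on the vertices of odd weight — the sets whose coset counts
`#(S ∩ c^{[|T| odd]} x_T H)` enter the lane's kernel decisions (`CyclicCMType.AbelianKernels.sum_char_eq_zero_iff_alternatingSum_…`, the terms
`(S.filter fun s => (g * Π_{ε_i} x_i)⁻¹ * s ∈ H).card` with `g ∈ {1, c}`) and whose field-side images are the cubes `S_F(σ, y)` of
`Pohlmann1968/MixedDifferenceCubeHodgeClasses` ∕ `…AbelianKernels` (`F = K^H`).  So the Hazama ∕ Pohlmann cube classes of the lane and White's
sporadic cycles are the same objects; the lane's contribution is the equivalence of their Hodge property with the kernel condition and the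
indexing by subfields, displacements and bases.  Elementary; theorems only.  HC_CM is NOT proved and not used.

## References

* [White1993SporadicCycles] S. P. White, Compositio Math. 88 (1993) 123–142, §4 Lemma 3 and Thm. 3 (p. 131).
* [Hazama2003CyclicCM] F. Hazama, J. Math. Sci. Univ. Tokyo 10 (2003), Prop. 3.2, Thm. 4.8, Remark 4.10.
* [Kubota1965] T. Kubota, Trans. AMS 118 (1965), §4 Lemma 2.
-/

noncomputable section

open scoped BigOperators Classical

namespace Literature.NumberTheory.ComplexMultiplication

namespace WhiteLenstra

variable {G : Type*} [CommGroup G] [Fintype G] [DecidableEq G]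

omit [Fintype G] [DecidableEq G] in
/-- A character turns products into products: `χ(Π_{i∈s} f_i) = Π_{i∈s} χ(f_i)`. [folklore] -/
private theorem map_prod_eq_prod (χ : AddChar (Additive G) ℂ) {ι : Type*} (s : Finset ι) (f : ι → G) :
    χ (Additive.ofMul (∏ i ∈ s, f i)) = ∏ i ∈ s, χ (Additive.ofMul (f i)) := by
  classical
  induction s using Finset.induction_on with
  | empty => simp
  | insert a s ha ih => rw [Finset.prod_insert ha, Finset.prod_insert ha, ofMul_mul, AddChar.map_add_eq_mul, ih]

omit [Fintype G] [DecidableEq G] in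
/-- **The character value of a cube vertex**: for `T ⊆ primes(N) ∖ {2}` and displacements with `χ(x_q) = ζ_q`,
`χ(c^{[|T| odd]}·Π_{q∈T} x_q) = z_{T'}` with `T' = T` (`|T|` even) or `T' = T ∪ {2}` (`|T|` odd) — White's "`σ^m = c`", `ζ₂ = −1`.
[cite: White1993SporadicCycles, §4 Lemma 3 (proof)] -/
theorem map_cubeVertex_eq_rootProd {N : ℕ} {χ : AddChar (Additive G) ℂ} {ρ : G} (hodd : χ (Additive.ofMul ρ) = -1)
    (x : ℕ → G) {T : Finset ℕ} (hT : T ⊆ N.primeFactors.erase 2) (hx : ∀ q ∈ N.primeFactors.erase 2, χ (Additive.ofMul (x q)) = zeta q) :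
    χ (Additive.ofMul ((if Even T.card then 1 else ρ) * ∏ q ∈ T, x q)) =
      rootProd (if Even T.card then T else insert 2 T) := by
  have h2T : 2 ∉ T := fun h => Finset.notMem_erase 2 N.primeFactors (hT h)
  have hprod : χ (Additive.ofMul (∏ q ∈ T, x q)) = rootProd T := by
    rw [map_prod_eq_prod]
    exact Finset.prod_congr rfl fun q hq => hx q (hT hq)
  rw [ofMul_mul, AddChar.map_add_eq_mul, hprod]
  split_ifs with he
  · rw [ofMul_one, AddChar.map_zero_eq_one, one_mul]
  · rw [hodd, rootProd_insert h2T, zeta_two]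

omit [DecidableEq G] in
/-- **WHITE'S `Δ` IS THE COSET CUBE.**  Let `χ` be a character of `G` with kernel `H` (`χ(g) = 1 ⟺ g ∈ H`), odd (`χ(c) = −1`), `N` even
(`2 ∣ N ≠ 0`, e.g. `N = ord χ`), and `x_q ∈ G` with `χ(x_q) = ζ_q` for the odd primes `q ∣ N` (the prime torsion `σ^{N/q}H` of `G/H`).  Then
`g ∈ Δ ⟺ g ∈ c^{[|T| odd]}·(Π_{q∈T} x_q)·H` for some `T ⊆ primes(N) ∖ {2}`: `Δ` is the union over the `2^{ω(N)−1}` vertices of the mixed-difference cube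
of `H` along the displacements `x_q`, with the conjugate base coset `cH` on the vertices of odd weight.
[cite: White1993SporadicCycles, §4 Lemma 3 and Thm. 3 (proofs, p. 131)] [cite: Hazama2003CyclicCM, Prop. 3.2, Thm. 4.8] -/
theorem mem_whiteSet_iff_exists_coset {N : ℕ} (h2 : 2 ∈ N.primeFactors) {χ : AddChar (Additive G) ℂ} {H : Subgroup G}
    (hker : ∀ g : G, χ (Additive.ofMul g) = 1 ↔ g ∈ H) {ρ : G} (hodd : χ (Additive.ofMul ρ) = -1)
    (x : ℕ → G) (hx : ∀ q ∈ N.primeFactors.erase 2, χ (Additive.ofMul (x q)) = zeta q) {g : G} :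
    g ∈ whiteSet N χ ↔ ∃ T ⊆ N.primeFactors.erase 2, ((if Even T.card then 1 else ρ) * ∏ q ∈ T, x q)⁻¹ * g ∈ H := by
  -- `y⁻¹ g ∈ H ⟺ χ(g) = χ(y)`
  have hcoset : ∀ y : G, y⁻¹ * g ∈ H ↔ χ (Additive.ofMul g) = χ (Additive.ofMul y) := fun y => by
    rw [← hker, ofMul_mul, ofMul_inv, AddChar.map_add_eq_mul, AddChar.map_neg_eq_inv]
    have hy : χ (Additive.ofMul y) ≠ 0 := fun h0 => by
      have h1 := AddChar.map_neg_eq_inv χ (Additive.ofMul y)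
      have h2' : χ (-Additive.ofMul y) * χ (Additive.ofMul y) = 1 := by
        rw [← AddChar.map_add_eq_mul, neg_add_cancel, AddChar.map_zero_eq_one]
      rw [h0, mul_zero] at h2'
      exact zero_ne_one h2'
    rw [inv_mul_eq_one₀ hy, eq_comm]
  rw [mem_whiteSet_iff]
  constructor
  · rintro ⟨T', hT', heven, hg⟩
    refine ⟨T'.erase 2, Finset.erase_subset_erase 2 hT', ?_⟩
    rw [hcoset, map_cubeVertex_eq_rootProd hodd x (Finset.erase_subset_erase 2 hT') hx, hg]
    congr 1
    by_cases h2T : 2 ∈ T'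
    · have hodd' : ¬ Even (T'.erase 2).card := by
        rw [Finset.card_erase_of_mem h2T, Nat.even_sub (Finset.card_pos.2 ⟨2, h2T⟩)]
        simpa using heven
      rw [if_neg hodd', Finset.insert_erase h2T]
    · rw [Finset.erase_eq_of_notMem h2T, if_pos heven]
  · rintro ⟨T, hT, hg⟩
    have h2T : 2 ∉ T := fun h => Finset.notMem_erase 2 N.primeFactors (hT h)
    have hTN : T ⊆ N.primeFactors := hT.trans (Finset.erase_subset 2 _)
    refine ⟨if Even T.card then T else insert 2 T, ?_, ?_, ?_⟩
    · split_ifs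
      · exact hTN
      · exact Finset.insert_subset h2 hTN
    · split_ifs with he
      · exact he
      · rw [Finset.card_insert_of_notMem h2T]
        exact Nat.even_add_one.2 he
    · rw [← map_cubeVertex_eq_rootProd hodd x hT hx]
      exact (hcoset _).1 hg

/-- **`Δ` as a union of `2^{ω(N)−1}` cosets of `H`** (the Finset form of `mem_whiteSet_iff_exists_coset`): with the coset of the vertex `T` written as
`{g | (c^{[|T| odd]} Π_{q∈T} x_q)⁻¹ g ∈ H}` — the shape of the coset counts `#(S ∩ g x_ε H)` in the lane's kernel decisions.
[cite: White1993SporadicCycles, §4 Lemma 3 and Thm. 3] [cite: Kubota1965, §4 Lemma 2] -/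
theorem whiteSet_eq_biUnion {N : ℕ} (h2 : 2 ∈ N.primeFactors) {χ : AddChar (Additive G) ℂ} {H : Subgroup G}
    (hker : ∀ g : G, χ (Additive.ofMul g) = 1 ↔ g ∈ H) {ρ : G} (hodd : χ (Additive.ofMul ρ) = -1)
    (x : ℕ → G) (hx : ∀ q ∈ N.primeFactors.erase 2, χ (Additive.ofMul (x q)) = zeta q) :
    whiteSet N χ = (N.primeFactors.erase 2).powerset.biUnion fun T =>
      Finset.univ.filter fun g : G => ((if Even T.card then 1 else ρ) * ∏ q ∈ T, x q)⁻¹ * g ∈ H := by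
  ext g
  rw [mem_whiteSet_iff_exists_coset h2 hker hodd x hx]
  simp only [Finset.mem_biUnion, Finset.mem_powerset, Finset.mem_filter, Finset.mem_univ, true_and]

omit [Fintype G] [DecidableEq G] in
/-- **The displacements exist**: if `χ(σ) = ζ_N` (`σH` generates `G/H ≅ ℤ/N`), then `x_q := σ^{N/q}` has `χ(x_q) = ζ_q` for every prime `q ∣ N` —
White's `σ^{2m/p}`. [cite: White1993SporadicCycles, §4 Lemma 3 (proof)] -/
theorem map_pow_div_eq_zeta {N : ℕ} (hN : N ≠ 0) {χ : AddChar (Additive G) ℂ} {σ : G} (hσ : χ (Additive.ofMul σ) = zeta N)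
    {q : ℕ} (hq : q ∈ N.primeFactors) : χ (Additive.ofMul (σ ^ (N / q))) = zeta q := by
  have hqN := Nat.dvd_of_mem_primeFactors hq
  have hq0 : q ≠ 0 := (Nat.prime_of_mem_primeFactors hq).ne_zero
  rw [ofMul_pow, AddChar.map_nsmul_eq_pow, hσ]
  unfold zeta
  rw [← Complex.exp_nat_mul]
  congr 1
  have hNq : ((N / q : ℕ) : ℂ) * (q : ℂ) = (N : ℂ) := by exact_mod_cast Nat.div_mul_cancel hqN
  have hN' : (N : ℂ) ≠ 0 := Nat.cast_ne_zero.2 hN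
  have hq' : (q : ℂ) ≠ 0 := Nat.cast_ne_zero.2 hq0
  have hdiv : ((N / q : ℕ) : ℂ) = (N : ℂ) / (q : ℂ) := by rw [eq_div_iff hq']; exact hNq
  rw [hdiv]
  field_simp

omit [DecidableEq G] in
/-- **White's `Δ` for the generator `σ`, as printed**: with `x_q = σ^{N/q}`,
`Δ = ⋃_{T ⊆ primes(N)∖{2}} c^{[|T| odd]} σ^{Σ_{q∈T} N/q} H`. [cite: White1993SporadicCycles, §4 Lemma 3 and Thm. 3 (p. 131)] -/
theorem mem_whiteSet_iff_exists_coset_pow {N : ℕ} (h2 : 2 ∈ N.primeFactors) {χ : AddChar (Additive G) ℂ} {H : Subgroup G}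
    (hker : ∀ g : G, χ (Additive.ofMul g) = 1 ↔ g ∈ H) {ρ σ : G} (hodd : χ (Additive.ofMul ρ) = -1)
    (hσ : χ (Additive.ofMul σ) = zeta N) {g : G} :
    g ∈ whiteSet N χ ↔ ∃ T ⊆ N.primeFactors.erase 2,
      ((if Even T.card then 1 else ρ) * σ ^ (∑ q ∈ T, N / q))⁻¹ * g ∈ H := by
  have hN : N ≠ 0 := (Nat.mem_primeFactors.1 h2).2.2
  rw [mem_whiteSet_iff_exists_coset h2 hker hodd (fun q => σ ^ (N / q))
    (fun q hq => map_pow_div_eq_zeta hN hσ (Finset.mem_of_mem_erase hq))]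
  refine exists_congr fun T => and_congr Iff.rfl ?_
  rw [Finset.prod_pow_eq_pow_sum]

end WhiteLenstra

end Literature.NumberTheory.ComplexMultiplication
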